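import Literature.Analysis.SpecialFunctions.SemigroupPosDef
import Mathlib.Analysis.Calculus.ContDiff.Convolution
import Mathlib.Analysis.Calculus.BumpFunction.Normed
import Mathlib.Analysis.Calculus.BumpFunction.FiniteDimension
import Mathlib.Analysis.Calculus.IteratedDeriv.Lemmas
import Mathlib.Analysis.Calculus.Deriv.Slope
import HarnessLib

/-!
# Positive-definite functions on `(0, ∞)`: limits, mixtures, derivatives and smoothing

Continuation of `Literature/Analysis/SpecialFunctions/SemigroupPosDef.lean`.  For the class of
functions `f : ℝ → ℝ` that are positive definite on the additive semigroup `(0,∞)`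
(`∀ m (s c : Fin m → ℝ), (∀ a, 0 < s a) → 0 ≤ ∑ a, ∑ b, c a * c b * f (s a + s b)`, written out)
and bounded above on every `[t₀,∞)` — by Bernstein–Widder exactly the completely monotone
functions [cite: Widder1941, Ch. IV Thm. 12a; Ch. VI Thm. 21], [cite: BergChristensenRessel1984,
Ch. 4 §4 and Thm. 6.13] — we prove, without measures:

* closure under pointwise limits (`SemigroupPosDef.of_tendsto`) and nonnegative mixtures
  (`SemigroupPosDef.integral`);
* **derivatives stay in the class**: for a differentiable member `G`, `-G'` is again positive
  definite and bounded above on every `[t₀,∞)` (`neg_deriv_mem`), hence for a smooth member all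
  `(-1)ⁿ G⁽ⁿ⁾` are in the class and in particular nonnegative on `(0,∞)`
  (`iteratedDeriv_alternating_nonneg`: smooth members are completely monotone);
* **smoothing inside the class** (`exists_smooth_approx`): a continuous member `g` is, for every
  `ε > 0`, squeezed as `g (t + ε) ≤ g_ε t ≤ g t` (`t > 0`) by a `C^∞` member `g_ε` (convolution
  with a bump supported in `(-ε, 0)`).

Together with the little Bernstein theorem (`Literature/Analysis/Complex/LittleBernstein*.lean`)
this yields the holomorphic extension of such functions to the right half-plane
(`Literature/Analysis/Complex/BernsteinWidderHalfPlane.lean`).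
-/

noncomputable section

open Finset Filter MeasureTheory Set
open scoped BigOperators fwdDiff Topology Convolution ContDiff

namespace Literature.Analysis.SpecialFunctions

namespace SemigroupPosDef

variable {f g : ℝ → ℝ}

/-! ### Limits and mixtures -/

/-- Positive definiteness on `(0,∞)` passes to pointwise limits on `(0,∞)`. [folklore] -/
theorem of_tendsto {ι : Type*} {l : Filter ι} [l.NeBot] {F : ι → ℝ → ℝ}
    (hF : ∀ i, (∀ (m : ℕ) (s c : Fin m → ℝ), (∀ k₀, 0 < s k₀) → 0 ≤ ∑ i₁, ∑ i₂, c i₁ * c i₂ * (F i (s i₁ + s i₂)))) (hlim : ∀ t, 0 < t → Tendsto (fun i => F i t) l (𝓝 (f t))) :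
    (∀ (m : ℕ) (s c : Fin m → ℝ), (∀ k₀, 0 < s k₀) → 0 ≤ ∑ i₁, ∑ i₂, c i₁ * c i₂ * (f (s i₁ + s i₂))) := by
  intro m s c hs
  have ht : Tendsto (fun i => ∑ a, ∑ b, c a * c b * F i (s a + s b)) l
      (𝓝 (∑ a, ∑ b, c a * c b * f (s a + s b))) :=
    tendsto_finsetSum _ fun a _ => tendsto_finsetSum _ fun b _ =>
      (hlim _ (add_pos (hs a) (hs b))).const_mul _
  exact ge_of_tendsto' ht fun i => hF i m s c hs

/-- Positive definiteness on `(0,∞)` passes to pointwise limits, eventually in the class. [folklore] -/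
theorem of_tendsto' {ι : Type*} {l : Filter ι} [l.NeBot] {F : ι → ℝ → ℝ}
    (hF : ∀ᶠ i in l, (∀ (m : ℕ) (s c : Fin m → ℝ), (∀ k₀, 0 < s k₀) → 0 ≤ ∑ i₁, ∑ i₂, c i₁ * c i₂ * (F i (s i₁ + s i₂))))
    (hlim : ∀ t, 0 < t → Tendsto (fun i => F i t) l (𝓝 (f t))) : (∀ (m : ℕ) (s c : Fin m → ℝ), (∀ k₀, 0 < s k₀) → 0 ≤ ∑ i₁, ∑ i₂, c i₁ * c i₂ * (f (s i₁ + s i₂))) := by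
  intro m s c hs
  have ht : Tendsto (fun i => ∑ a, ∑ b, c a * c b * F i (s a + s b)) l
      (𝓝 (∑ a, ∑ b, c a * c b * f (s a + s b))) :=
    tendsto_finsetSum _ fun a _ => tendsto_finsetSum _ fun b _ =>
      (hlim _ (add_pos (hs a) (hs b))).const_mul _
  exact ge_of_tendsto ht (hF.mono fun i hi => hi m s c hs)

/-- Nonnegative mixtures `t ↦ ∫ F w t dμ(w)` of positive definite functions are positive definite
(the integrals over `(0,∞)`-points being genuine). [folklore] -/
theorem integral {Ω : Type*} [MeasurableSpace Ω] {μ : Measure Ω} {F : Ω → ℝ → ℝ}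
    (hF : ∀ w, (∀ (m : ℕ) (s c : Fin m → ℝ), (∀ k₀, 0 < s k₀) → 0 ≤ ∑ i₁, ∑ i₂, c i₁ * c i₂ * (F w (s i₁ + s i₂)))) (hint : ∀ t, 0 < t → Integrable (fun w => F w t) μ) :
    (∀ (m : ℕ) (s c : Fin m → ℝ), (∀ k₀, 0 < s k₀) → 0 ≤ ∑ i₁, ∑ i₂, c i₁ * c i₂ * (∫ w, F w (s i₁ + s i₂) ∂μ)) := by
  intro m s c hs
  have key : ∑ a, ∑ b, c a * c b * ∫ w, F w (s a + s b) ∂μ =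
      ∫ w, ∑ a, ∑ b, c a * c b * F w (s a + s b) ∂μ := by
    rw [integral_finsetSum _ fun a _ => ?_]
    · refine Finset.sum_congr rfl fun a _ => ?_
      rw [integral_finsetSum _ fun b _ => ?_]
      · exact Finset.sum_congr rfl fun b _ => (integral_const_mul _ _).symm
      · exact (hint _ (add_pos (hs a) (hs b))).const_mul _
    · exact integrable_finsetSum _ fun b _ => (hint _ (add_pos (hs a) (hs b))).const_mul _
  rw [key]
  exact integral_nonneg fun w => hF w m s c hs

/-! ### Derivatives of members of the class -/

/-- For a differentiable `f`, positive definite on `(0,∞)` and bounded above on every `[t₀,∞)`,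
the function `-f'` is again positive definite: it is the pointwise limit of the positive definite
functions `-(Δ_[h] f)/h`, `h → 0⁺`. [cite: Widder1941, Ch. IV §3] -/
theorem neg_deriv (h : (∀ (m : ℕ) (s c : Fin m → ℝ), (∀ k₀, 0 < s k₀) → 0 ≤ ∑ i₁, ∑ i₂, c i₁ * c i₂ * (f (s i₁ + s i₂)))) (hb : (∀ t₀ : ℝ, 0 < t₀ → ∃ M : ℝ, ∀ τ : ℝ, t₀ ≤ τ → (f τ) ≤ M)) (hd : Differentiable ℝ f) :
    (∀ (m : ℕ) (s c : Fin m → ℝ), (∀ k₀, 0 < s k₀) → 0 ≤ ∑ i₁, ∑ i₂, c i₁ * c i₂ * (-deriv f (s i₁ + s i₂))) := by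
  have hPD : ∀ u : ℝ, 0 < u → (∀ (m : ℕ) (s c : Fin m → ℝ), (∀ k₀, 0 < s k₀) → 0 ≤ ∑ i₁, ∑ i₂, c i₁ * c i₂ * (u⁻¹ * (-Δ_[u] f) (s i₁ + s i₂))) := fun u hu =>
    const_mul (f := -Δ_[u] f) (neg_fwdDiff h hb hu.le).1 (inv_nonneg.mpr hu.le)
  refine of_tendsto' (f := fun t => -deriv f t) (l := 𝓝[>] (0 : ℝ))
    (F := fun u t => u⁻¹ * (-Δ_[u] f) t) ?_ ?_
  · filter_upwards [self_mem_nhdsWithin] with u hu using hPD u hu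
  · intro t _
    have h1 : Tendsto (fun u => u⁻¹ • (f (t + u) - f t)) (𝓝[≠] 0) (𝓝 (deriv f t)) :=
      hasDerivAt_iff_tendsto_slope_zero.mp (hd t).hasDerivAt
    have h2 : Tendsto (fun u => u⁻¹ • (f (t + u) - f t)) (𝓝[>] 0) (𝓝 (deriv f t)) :=
      h1.mono_left (nhdsWithin_mono _ fun x hx => ne_of_gt hx)
    have h3 := h2.neg
    refine h3.congr fun u => ?_
    simp only [fwdDiff, smul_eq_mul, Pi.neg_apply]
    ring

/-- For a differentiable member `f` of the class, `-f'` is bounded above on every `[t₀,∞)` (by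
`-f'(t₀)`: the quotients `-(Δ_[h] f)/h` are non-increasing on `(0,∞)`). [cite: Widder1941, Ch. IV §3] -/
theorem neg_deriv_bdd (h : (∀ (m : ℕ) (s c : Fin m → ℝ), (∀ k₀, 0 < s k₀) → 0 ≤ ∑ i₁, ∑ i₂, c i₁ * c i₂ * (f (s i₁ + s i₂)))) (hb : (∀ t₀ : ℝ, 0 < t₀ → ∃ M : ℝ, ∀ τ : ℝ, t₀ ≤ τ → (f τ) ≤ M)) (hd : Differentiable ℝ f) :
    (∀ t₀ : ℝ, 0 < t₀ → ∃ M : ℝ, ∀ τ : ℝ, t₀ ≤ τ → (-deriv f τ) ≤ M) := by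
  intro t₀ ht₀
  refine ⟨-deriv f t₀, fun t ht => ?_⟩
  -- compare the difference quotients and pass to the limit `h → 0⁺`
  have hq : ∀ u : ℝ, 0 < u → u⁻¹ * (-Δ_[u] f) t ≤ u⁻¹ * (-Δ_[u] f) t₀ := by
    intro u hu
    have hmono := antitoneOn (neg_fwdDiff h hb hu.le).1 (neg_fwdDiff h hb hu.le).2
    exact mul_le_mul_of_nonneg_left (hmono (mem_Ioi.mpr ht₀) (mem_Ioi.mpr (ht₀.trans_le ht)) ht)
      (inv_nonneg.mpr hu.le)
  have hlim : ∀ x : ℝ, Tendsto (fun u => u⁻¹ * (-Δ_[u] f) x) (𝓝[>] 0) (𝓝 (-deriv f x)) := by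
    intro x
    have h1 : Tendsto (fun u => u⁻¹ • (f (x + u) - f x)) (𝓝[≠] 0) (𝓝 (deriv f x)) :=
      hasDerivAt_iff_tendsto_slope_zero.mp (hd x).hasDerivAt
    have h2 : Tendsto (fun u => u⁻¹ • (f (x + u) - f x)) (𝓝[>] 0) (𝓝 (deriv f x)) :=
      h1.mono_left (nhdsWithin_mono _ fun y hy => ne_of_gt hy)
    refine h2.neg.congr fun u => ?_
    simp only [fwdDiff, smul_eq_mul, Pi.neg_apply]
    ring
  exact le_of_tendsto_of_tendsto (hlim t) (hlim t₀)
    (by filter_upwards [self_mem_nhdsWithin] with u hu using hq u hu)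

/-- **Derivatives stay in the class**: if `f` is differentiable, positive definite on `(0,∞)` and
bounded above on every `[t₀,∞)`, then so is `-f'`. [cite: Widder1941, Ch. IV §3] -/
theorem neg_deriv_mem (h : (∀ (m : ℕ) (s c : Fin m → ℝ), (∀ k₀, 0 < s k₀) → 0 ≤ ∑ i₁, ∑ i₂, c i₁ * c i₂ * (f (s i₁ + s i₂)))) (hb : (∀ t₀ : ℝ, 0 < t₀ → ∃ M : ℝ, ∀ τ : ℝ, t₀ ≤ τ → (f τ) ≤ M)) (hd : Differentiable ℝ f) :
    (∀ (m : ℕ) (s c : Fin m → ℝ), (∀ k₀, 0 < s k₀) → 0 ≤ ∑ i₁, ∑ i₂, c i₁ * c i₂ * (-deriv f (s i₁ + s i₂))) ∧ (∀ t₀ : ℝ, 0 < t₀ → ∃ M : ℝ, ∀ τ : ℝ, t₀ ≤ τ → (-deriv f τ) ≤ M) :=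
  ⟨neg_deriv h hb hd, neg_deriv_bdd h hb hd⟩

/-- **Smooth members are completely monotone**: all `(-1)ⁿ f⁽ⁿ⁾` belong to the class.
[cite: Widder1941, Ch. IV Thm. 12a] -/
theorem iteratedDeriv_alternating_mem (h : (∀ (m : ℕ) (s c : Fin m → ℝ), (∀ k₀, 0 < s k₀) → 0 ≤ ∑ i₁, ∑ i₂, c i₁ * c i₂ * (f (s i₁ + s i₂)))) (hb : (∀ t₀ : ℝ, 0 < t₀ → ∃ M : ℝ, ∀ τ : ℝ, t₀ ≤ τ → (f τ) ≤ M)) (hd : ContDiff ℝ ∞ f) (n : ℕ) :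
    (∀ (m : ℕ) (s c : Fin m → ℝ), (∀ k₀, 0 < s k₀) → 0 ≤ ∑ i₁, ∑ i₂, c i₁ * c i₂ * ((-1 : ℝ) ^ n * iteratedDeriv n f (s i₁ + s i₂))) ∧ (∀ t₀ : ℝ, 0 < t₀ → ∃ M : ℝ, ∀ τ : ℝ, t₀ ≤ τ → ((-1 : ℝ) ^ n * iteratedDeriv n f τ) ≤ M) := by
  induction n with
  | zero => simpa using And.intro h hb
  | succ n ih =>
    have hdn : Differentiable ℝ (fun t => (-1 : ℝ) ^ n * iteratedDeriv n f t) :=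
      ((hd.differentiable_iteratedDeriv n (mod_cast ENat.coe_lt_top n)).const_mul _)
    have step := neg_deriv_mem (f := fun t => (-1 : ℝ) ^ n * iteratedDeriv n f t) ih.1 ih.2 hdn
    have e : (fun t => -deriv (fun t => (-1 : ℝ) ^ n * iteratedDeriv n f t) t) =
        fun t => (-1 : ℝ) ^ (n + 1) * iteratedDeriv (n + 1) f t := by
      ext t
      rw [deriv_const_mul _ ((hd.differentiable_iteratedDeriv n (mod_cast ENat.coe_lt_top n)) t),
        iteratedDeriv_succ, pow_succ]
      ring
    have e' : ∀ t, -deriv (fun t => (-1 : ℝ) ^ n * iteratedDeriv n f t) t =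
        (-1 : ℝ) ^ (n + 1) * iteratedDeriv (n + 1) f t := fun t => congr_fun e t
    simp only [e'] at step
    exact step

/-- Pointwise form: a smooth function, positive definite on `(0,∞)` and bounded above on every
`[t₀,∞)`, satisfies `0 ≤ (-1)ⁿ f⁽ⁿ⁾(t)` for `t > 0`. [cite: Widder1941, Ch. IV Thm. 12a] -/
theorem iteratedDeriv_alternating_nonneg (h : (∀ (m : ℕ) (s c : Fin m → ℝ), (∀ k₀, 0 < s k₀) → 0 ≤ ∑ i₁, ∑ i₂, c i₁ * c i₂ * (f (s i₁ + s i₂)))) (hb : (∀ t₀ : ℝ, 0 < t₀ → ∃ M : ℝ, ∀ τ : ℝ, t₀ ≤ τ → (f τ) ≤ M)) (hd : ContDiff ℝ ∞ f)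
    (n : ℕ) {t : ℝ} (ht : 0 < t) : 0 ≤ (-1 : ℝ) ^ n * iteratedDeriv n f t :=
  nonneg (f := fun t => (-1 : ℝ) ^ n * iteratedDeriv n f t) (iteratedDeriv_alternating_mem h hb hd n).1 ht

/-! ### Smoothing inside the class -/

/-- **Smoothing inside the class.**  Let `g : ℝ → ℝ` be continuous, positive definite on `(0,∞)`
and bounded above on every `[t₀,∞)`.  For every `ε > 0` there is a `C^∞` function `gε`, again
positive definite on `(0,∞)` and bounded above on every `[t₀,∞)`, with
`g (t + ε) ≤ gε t ≤ g t` for all `t > 0` (a bump-weighted average of the translates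
`g(· + v)`, `0 < v < ε`: convolution with the normalised bump of centre `-ε/2` and radii
`ε/4 < ε/2`). [folklore] -/
theorem exists_smooth_approx (h : (∀ (m : ℕ) (s c : Fin m → ℝ), (∀ k₀, 0 < s k₀) → 0 ≤ ∑ i₁, ∑ i₂, c i₁ * c i₂ * (g (s i₁ + s i₂)))) (hb : (∀ t₀ : ℝ, 0 < t₀ → ∃ M : ℝ, ∀ τ : ℝ, t₀ ≤ τ → (g τ) ≤ M)) (hc : Continuous g) {ε : ℝ} (hε : 0 < ε) :
    ∃ gε : ℝ → ℝ, ContDiff ℝ ∞ gε ∧ (∀ (m : ℕ) (s c : Fin m → ℝ), (∀ k₀, 0 < s k₀) → 0 ≤ ∑ i₁, ∑ i₂, c i₁ * c i₂ * (gε (s i₁ + s i₂))) ∧ (∀ t₀ : ℝ, 0 < t₀ → ∃ M : ℝ, ∀ τ : ℝ, t₀ ≤ τ → (gε τ) ≤ M) ∧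
      ∀ t, 0 < t → g (t + ε) ≤ gε t ∧ gε t ≤ g t := by
  -- the one-sided bump supported in `(-ε, 0)`
  let φ : ContDiffBump (-(ε / 2) : ℝ) := ⟨ε / 4, ε / 2, by positivity, by linarith⟩
  set ψ : ℝ → ℝ := φ.normed volume with hψ
  have hψc : ContDiff ℝ ∞ ψ := φ.contDiff_normed
  have hψs : HasCompactSupport ψ := φ.hasCompactSupport_normed
  have hψ0 : ∀ t, 0 ≤ ψ t := φ.nonneg_normed
  have hψ1 : ∫ t, ψ t = 1 := φ.integral_normed
  have hψz : ∀ t, t ∉ Ioo (-ε) 0 → ψ t = 0 := by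
    intro t ht
    have : t ∉ Function.support ψ := by
      rw [hψ, ContDiffBump.support_normed_eq]
      intro hmem
      rw [Metric.mem_ball, Real.dist_eq] at hmem
      apply ht
      have hr : φ.rOut = ε / 2 := rfl
      rw [hr] at hmem
      constructor <;> [linarith [(abs_lt.mp hmem).1]; linarith [(abs_lt.mp hmem).2]]
    simpa [Function.mem_support] using this
  -- the smoothed function
  set gε : ℝ → ℝ := ψ ⋆[ContinuousLinearMap.lsmul ℝ ℝ, volume] g with hgε
  have hdef : ∀ x, gε x = ∫ t, ψ t * g (x - t) := fun x => by
    rw [hgε, convolution_lsmul]; rfl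
  have hint : ∀ x, Integrable (fun t => ψ t * g (x - t)) := fun x =>
    ((hψc.continuous.mul (hc.comp (continuous_const.sub continuous_id))).integrable_of_hasCompactSupport
      (hψs.mul_right))
  refine ⟨gε, hψs.contDiff_convolution_left _ hψc hc.locallyIntegrable, ?_, ?_, ?_⟩
  · -- positive definite: mixture of translates
    have : gε = fun x => ∫ t, ψ t * g (x - t) := funext hdef
    rw [this]
    refine SemigroupPosDef.integral (F := fun t x => ψ t * g (x - t)) (fun t => ?_) (fun x _ => hint x)
    by_cases ht : t ∈ Ioo (-ε) 0
    · have hs := const_mul (f := fun x => g (x + -t)) (shift h (u := -t) (by linarith [ht.2])) (hψ0 t)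
      simpa [sub_eq_add_neg] using hs
    · simp only [hψz t ht, zero_mul]
      exact fun m s c _ => by simp
  · -- bounded above on `[t₀, ∞)`
    intro t₀ ht₀
    obtain ⟨M, hM⟩ := hb t₀ ht₀
    refine ⟨M, fun x hx => ?_⟩
    rw [hdef]
    calc ∫ t, ψ t * g (x - t) ≤ ∫ t, ψ t * M := by
          refine integral_mono (hint x)
            ((hψc.continuous.mul continuous_const).integrable_of_hasCompactSupport hψs.mul_right)
            fun t => ?_
          by_cases ht : t ∈ Ioo (-ε) 0
          · exact mul_le_mul_of_nonneg_left (hM _ (by linarith [ht.2])) (hψ0 t)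
          · simp [hψz t ht]
      _ = M := by rw [integral_mul_const, hψ1, one_mul]
  · -- the squeeze `g (x + ε) ≤ gε x ≤ g x` for `x > 0`
    intro x hx
    have hanti := antitoneOn h hb
    have hlow : ∀ t, ψ t * g (x + ε) ≤ ψ t * g (x - t) := by
      intro t
      by_cases ht : t ∈ Ioo (-ε) 0
      · exact mul_le_mul_of_nonneg_left
          (hanti (mem_Ioi.mpr (by linarith [ht.2])) (mem_Ioi.mpr (by linarith)) (by linarith [ht.1]))
          (hψ0 t)
      · simp [hψz t ht]
    have hup : ∀ t, ψ t * g (x - t) ≤ ψ t * g x := by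
      intro t
      by_cases ht : t ∈ Ioo (-ε) 0
      · exact mul_le_mul_of_nonneg_left
          (hanti (mem_Ioi.mpr hx) (mem_Ioi.mpr (by linarith [ht.2])) (by linarith [ht.2])) (hψ0 t)
      · simp [hψz t ht]
    have hi1 : Integrable (fun t => ψ t * g (x + ε)) :=
      (hψc.continuous.mul continuous_const).integrable_of_hasCompactSupport hψs.mul_right
    have hi2 : Integrable (fun t => ψ t * g x) :=
      (hψc.continuous.mul continuous_const).integrable_of_hasCompactSupport hψs.mul_right
    constructor
    · calc g (x + ε) = ∫ t, ψ t * g (x + ε) := by rw [integral_mul_const, hψ1, one_mul]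
        _ ≤ ∫ t, ψ t * g (x - t) := integral_mono hi1 (hint x) hlow
        _ = gε x := (hdef x).symm
    · calc gε x = ∫ t, ψ t * g (x - t) := hdef x
        _ ≤ ∫ t, ψ t * g x := integral_mono (hint x) hi2 hup
        _ = g x := by rw [integral_mul_const, hψ1, one_mul]

end SemigroupPosDef

end Literature.Analysis.SpecialFunctions
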